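import Summits.NavierStokesRegularity.OSWSelfSimilar.SheetREvansOdd
import Summits.NavierStokesRegularity.OSWSelfSimilar.SheetRLinearisationPerturbation
import Summits.NavierStokesRegularity.OSWSelfSimilar.SheetRCertificateAssembly
import HarnessLib

/-!
# SHEET-ℝ: the two encodings of the linearisation at the certified zero `Ω* = Ω̄ + u` define THE SAME weak form —
# `(drift a Ω*, potential L λ Ω*, −PopC* + F′)` (coefficients at `Ω*`) versus `(drift a Ω̄, potential L λ Ω̄, −PopC̄ + F′ + B_u)`
# (coefficients at the centre, (P8)'s `B_u = Qop u + (Qop)ᵀ u`); hence the (S1) Gårding datum transfers between them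

HONEST FRAMING (cell ns-blowup GROUP B / zone Z3, case Z3-SR-SPEC, the glue between P-list (P8) — cert-5 g6
`SheetRLinearisationPerturbation.gardingDataKC_perturbedCentre`, which delivers the (S1) datum AT `Ω*` in the CENTRE encoding
`(d̄, V̄, K̄ + B_u)` — and the S2 kernel assembly `SheetRSpectrumOddAssembly` + the (P6) transport `SheetRTimeShiftModeWeakEigen`, which are
written in the `Ω*` encoding `(d*, V*, −PopC* + F′)`; 1-D MODEL certificate frame (viscous gCLM/OSW sheet on the line); not Euler/NS;
«violates: none — MODEL»). Nothing here asserts that a profile exists or that any datum holds: two centre data `IsCentre L Ω̄ Ω̄₁ H₀`,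
`IsCentre L Ω* Ω*₁ H₀*` with `Ω* = Ω̄ + prim (der u)` pointwise (`u ∈ Esp`) are the HYPOTHESES.
CONTENT.
* §1 `ae_eq_add_der` — `Ω*₁ = Ω̄₁ + der u` a.e. (both sides are a.e. derivatives of `Ω*`); `hilbert_add`, `velocity_add` — `HΩ* = HΩ̄ + Hu₀`,
  `𝒰Ω* = 𝒰Ω̄ + 𝒰u₀` pointwise (`SheetRWeakPairingExpansion`).
* §2 **`weakForm_reencode`** — for every `p ∈ Esp`, every bounded `F′` and every compactly supported test `(φ, φ₁)`:
  `linForm L (drift a Ω*) (potential L λ Ω*) p₀ p₁ φ φ₁ + ∫ w·((−PopC* + F′)p)·φ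
     = linForm L (drift a Ω̄) (potential L λ Ω̄) p₀ p₁ φ φ₁ + ∫ w·((−PopC̄ + F′ + (Qop u + (Qop)ᵀ u))p)·φ`
  (pointwise: `d* − d̄ = a𝒰u₀`, `V* − V̄ = −Hu₀`, `P*p − P̄p = u₀·Hp₀ − a u₁·𝒰p₀`, and `B_u p = (a𝒰u₀·p₁ − Hu₀·p₀) + (a𝒰p₀·u₁ − Hp₀·u₀)`
  — the four differences cancel identically).
* §4 (APPEND) `pairOpKC_reencode`, `resolventKC_reencode`, `resolventOdd_reencode`, **`evansOdd_reencode`** — for data of the two encodings with the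
  same `m` the pair solution operators, the resolvents (on `L²_w(ℂ)` and on the odd class) and hence the Evans functions COINCIDE (uniqueness of the
  shifted weak pair system + `weakForm_reencode`): a certificate for the centre-encoded `E` is a certificate for the `Ω*`-encoded one.
* §3 **`gardingDataKC_reencode`** / `gardingDataKC_reencode'` — the Gårding datum `(c, m)` holds in one encoding iff in the other (same
  inequality on tests; the coefficient fields come from `coef_bounds` at the respective centre); `isWeakImage_reencode` — likewise for
  selfsim's `IsWeakImage`. So the S2 assembly may be fed, in the `Ω*` encoding, with the (S1) datum of the centre moved by (P8) and the (P6)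
  weak eigenvector of `SheetRTimeShiftModeWeakEigen` — ONE `(d, V, K)` for both hypotheses.
No definition, no named fact. WHAT THIS IS NOT: not NS; not the spectral certificate; no number of record moves.
-/

noncomputable section

namespace Summit.NavierStokesRegularity.OSWSelfSimilar
namespace SheetRCentreReencoding

open _root_.MeasureTheory _root_.Set _root_.Filter _root_.Real Literature.Analysis.Fourier SheetRWeakProfilePV SheetRWeakToStrong
  SheetREnergyClass SheetRWeightedMeasure SheetREnergySpace SheetRLinearisedTests SheetRTestSpace SheetRLinearisedFormBounds
  SheetRSolutionOperator SheetRComplexPivot SheetRAssemblyOperators SheetRCertificateAssembly SheetRGeneratorOddWeak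
  SheetRWeakPairingExpansion SheetRLinearisationPerturbation SheetRPerturbedResolventC SheetRPerturbedResolventIdentityC
  SheetROddClass SheetRResolventOddClass SheetREvansOdd
open scoped Topology ENNReal

variable {L : ℝ} (hL : 0 < L) (lam a : ℝ) {Ω Ω₁ Ωs Ωs₁ : ℝ → ℝ} {H₀ Hs : ℝ}
  (hc : IsCentre L Ω Ω₁ H₀) (hcs : IsCentre L Ωs Ωs₁ Hs) (u : Esp L hL) (hsum : ∀ y, Ωs y = Ω y + prim (der u) y)

/-! ### §1 The two centres: `Ω*₁ = Ω̄₁ + u₁` a.e., `HΩ* = HΩ̄ + Hu₀`, `𝒰Ω* = 𝒰Ω̄ + 𝒰u₀` -/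

include hc hcs hsum in
/-- `Ω*₁ = Ω̄₁ + der u` almost everywhere: both are a.e. derivatives of `Ω* = Ω̄ + prim (der u)`. [folklore] -/
theorem ae_eq_add_der : Ωs₁ =ᵐ[volume] fun y => Ω₁ y + der u y := by
  obtain ⟨-, hΩ₁2, -, -, -⟩ := hc.basic hL
  obtain ⟨-, hΩs₁2, -, -, -⟩ := hcs.basic hL
  obtain ⟨hu₁2, -, -⟩ := basic_of_mem hL u
  filter_upwards [_root_.LocallyIntegrable.ae_hasDerivAt_integral (hΩ₁2.locallyIntegrable one_le_two),
    _root_.LocallyIntegrable.ae_hasDerivAt_integral (hΩs₁2.locallyIntegrable one_le_two),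
    _root_.LocallyIntegrable.ae_hasDerivAt_integral (hu₁2.locallyIntegrable one_le_two)] with y h1 h2 h3
  have e1 : Ω = fun x => ∫ s in (0 : ℝ)..x, Ω₁ s := funext hc.primitive
  have e2 : Ωs = fun x => ∫ s in (0 : ℝ)..x, Ωs₁ s := funext hcs.primitive
  have e3 : Ωs = fun x => (∫ s in (0 : ℝ)..x, Ω₁ s) + ∫ s in (0 : ℝ)..x, der u s := by
    funext x; rw [hsum x, hc.primitive x, prim_apply]
  have hA : HasDerivAt Ωs (Ωs₁ y) y := by rw [e2]; exact h2 0
  have hB : HasDerivAt Ωs (Ω₁ y + der u y) y := by rw [e3]; exact (h1 0).add (h3 0)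
  exact hA.unique hB

include hc hsum in
/-- `HΩ* = HΩ̄ + H(prim (der u))` pointwise. [folklore] -/
theorem hilbert_add (y : ℝ) : hilbertTransform Ωs y = hilbertTransform Ω y + hilbertTransform (prim (der u)) y := by
  obtain ⟨-, hΩ₁2, -, hΩi, -⟩ := hc.basic hL
  obtain ⟨hu₁2, hui, -⟩ := basic_of_mem hL u
  obtain ⟨hu, -, -, -, -, -⟩ := profile_of_mem hL u
  rw [show Ωs = fun y => Ω y + prim (der u) y from funext hsum]
  exact hilbertTransform_add_of_primitive hc.primitive' hΩ₁2 hΩi hu hu₁2 hui y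

include hc hsum in
/-- `𝒰Ω* = 𝒰Ω̄ + 𝒰(prim (der u))` pointwise. [folklore] -/
theorem velocity_add (y : ℝ) : ∫ s in (0 : ℝ)..y, hilbertTransform Ωs s =
    (∫ s in (0 : ℝ)..y, hilbertTransform Ω s) + ∫ s in (0 : ℝ)..y, hilbertTransform (prim (der u)) s := by
  obtain ⟨-, hΩ₁2, hΩ2, hΩi, -⟩ := hc.basic hL
  obtain ⟨hu₁2, hui, hu2⟩ := basic_of_mem hL u
  obtain ⟨hu, -, -, -, -, -⟩ := profile_of_mem hL u
  rw [show Ωs = fun y => Ω y + prim (der u) y from funext hsum]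
  exact velocity_add_of_primitive hc.primitive' hΩ₁2 hΩi hΩ2 hu hu₁2 hui hu2 y

/-! ### §2 The weak forms of the two encodings coincide -/

include hc hcs hsum in
/-- **RE-ENCODING OF THE WEAK FORM.** For `p ∈ Esp` (profile `p₀ = prim (der p)`, `p₁ = der p`), a bounded `F′ : Esp →L L²_w` and a
compactly supported test `(φ, φ₁)`:
`linForm L (drift a Ω*) (potential L λ Ω*) p₀ p₁ φ φ₁ + ∫ w·((−PopC* + F′)p)·φ
   = linForm L (drift a Ω̄) (potential L λ Ω̄) p₀ p₁ φ φ₁ + ∫ w·((−PopC̄ + F′ + (Qop u + (Qop)ᵀ u))p)·φ`.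
MODEL statement; not NS. [folklore] -/
theorem weakForm_reencode (F' : Esp L hL →L[ℝ] W L) (p : Esp L hL) {φ φ₁ : ℝ → ℝ} (hφ : IsCompactTest φ φ₁) :
    linForm L (drift a Ωs) (potential L lam Ωs) (prim (der p)) (der p) φ φ₁
        + ∫ y, (L ^ 2 + y ^ 2) * ((((-PopC hL lam a hcs + F') p : W L) : ℝ → ℝ) y * φ y) =
      linForm L (drift a Ω) (potential L lam Ω) (prim (der p)) (der p) φ φ₁
        + ∫ y, (L ^ 2 + y ^ 2) *
          ((((-PopC hL lam a hc + F' + (Qop hL a u + (Qop hL a).flip u)) p : W L) : ℝ → ℝ) y * φ y) := by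
  obtain ⟨hdm, hVm, hd, hV⟩ := coef_bounds hL lam a hc
  obtain ⟨hdms, hVms, hds, hVs⟩ := coef_bounds hL lam a hcs
  obtain ⟨-, -, hpm, hp0, hp1, -⟩ := profile_of_mem hL p
  have hpc : Continuous (prim (der p)) := continuous_prim hL _
  -- integrability of the two weak-form integrands
  obtain ⟨hIs, -⟩ := abs_linForm_le (d := drift a Ωs) (V := potential L lam Ωs) hL hdms hVms (by norm_num : (0:ℝ) ≤ 1 / 2) hds hVs hφ
    hpc.aestronglyMeasurable hpm hp0 hp1
  obtain ⟨hI, -⟩ := abs_linForm_le (d := drift a Ω) (V := potential L lam Ω) hL hdm hVm (by norm_num : (0:ℝ) ≤ 1 / 2) hd hV hφ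
    hpc.aestronglyMeasurable hpm hp0 hp1
  -- the `P`-terms and the `B_u`-term as integrals of functions
  have hPs : ∫ y, (L ^ 2 + y ^ 2) * (((PopC hL lam a hcs p : W L) : ℝ → ℝ) y * φ y) =
      ∫ y, (L ^ 2 + y ^ 2) * (PopFun L lam a Ωs Ωs₁ p y * φ y) :=
    integral_congr_ae ((PopC_apply hL lam a hcs p).mono fun y hy => by simp only [hy])
  have hP : ∫ y, (L ^ 2 + y ^ 2) * (((PopC hL lam a hc p : W L) : ℝ → ℝ) y * φ y) =
      ∫ y, (L ^ 2 + y ^ 2) * (PopFun L lam a Ω Ω₁ p y * φ y) :=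
    integral_congr_ae ((PopC_apply hL lam a hc p).mono fun y hy => by simp only [hy])
  have hBae : ((((Qop hL a u + (Qop hL a).flip u) p : W L)) : ℝ → ℝ) =ᵐ[volume] fun y => QFun L a u p y + QFun L a p u y := by
    rw [secondVariation_apply]
    filter_upwards [ae_volume_of_ae_μw hL (Lp.coeFn_add (Qop hL a u p : W L) (Qop hL a p u : W L)), (Qop_apply hL a u p).1,
      (Qop_apply hL a p u).1] with y hy h1 h2
    rw [hy, Pi.add_apply, h1, h2]
  have hB : ∫ y, (L ^ 2 + y ^ 2) * ((((Qop hL a u + (Qop hL a).flip u) p : W L) : ℝ → ℝ) y * φ y) =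
      ∫ y, (L ^ 2 + y ^ 2) * ((QFun L a u p y + QFun L a p u y) * φ y) :=
    integral_congr_ae (hBae.mono fun y hy => by simp only [hy])
  have iPs : Integrable fun y => (L ^ 2 + y ^ 2) * (PopFun L lam a Ωs Ωs₁ p y * φ y) :=
    (integrable_weight_mul_test hL (PopC hL lam a hcs p) hφ).congr ((PopC_apply hL lam a hcs p).mono fun y hy => by simp only [hy])
  have iP : Integrable fun y => (L ^ 2 + y ^ 2) * (PopFun L lam a Ω Ω₁ p y * φ y) :=
    (integrable_weight_mul_test hL (PopC hL lam a hc p) hφ).congr ((PopC_apply hL lam a hc p).mono fun y hy => by simp only [hy])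
  have iB : Integrable fun y => (L ^ 2 + y ^ 2) * ((QFun L a u p y + QFun L a p u y) * φ y) :=
    (integrable_weight_mul_test hL ((Qop hL a u + (Qop hL a).flip u) p) hφ).congr (hBae.mono fun y hy => by simp only [hy])
  -- the pointwise identity (a.e., where `Ω*₁ = Ω̄₁ + u₁`)
  have key : ∀ᵐ y : ℝ,
      ((L ^ 2 + y ^ 2) * (der p y * φ₁ y) + 2 * y * (der p y * φ y) + (L ^ 2 + y ^ 2) * drift a Ωs y * (der p y * φ y)
          + (L ^ 2 + y ^ 2) * potential L lam Ωs y * (prim (der p) y * φ y))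
        - (L ^ 2 + y ^ 2) * (PopFun L lam a Ωs Ωs₁ p y * φ y) =
      ((L ^ 2 + y ^ 2) * (der p y * φ₁ y) + 2 * y * (der p y * φ y) + (L ^ 2 + y ^ 2) * drift a Ω y * (der p y * φ y)
          + (L ^ 2 + y ^ 2) * potential L lam Ω y * (prim (der p) y * φ y))
        - (L ^ 2 + y ^ 2) * (PopFun L lam a Ω Ω₁ p y * φ y)
        + (L ^ 2 + y ^ 2) * ((QFun L a u p y + QFun L a p u y) * φ y) := by
    filter_upwards [ae_eq_add_der hL hc hcs u hsum] with y hy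
    simp only [drift, potential, PopFun, QFun]
    rw [hilbert_add hL hc u hsum y, velocity_add hL hc u hsum y, hy, hsum y]
    ring
  have hlinS : linForm L (drift a Ωs) (potential L lam Ωs) (prim (der p)) (der p) φ φ₁ =
      ∫ y, ((L ^ 2 + y ^ 2) * (der p y * φ₁ y) + 2 * y * (der p y * φ y) + (L ^ 2 + y ^ 2) * drift a Ωs y * (der p y * φ y)
          + (L ^ 2 + y ^ 2) * potential L lam Ωs y * (prim (der p) y * φ y)) := rfl
  have hlin : linForm L (drift a Ω) (potential L lam Ω) (prim (der p)) (der p) φ φ₁ =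
      ∫ y, ((L ^ 2 + y ^ 2) * (der p y * φ₁ y) + 2 * y * (der p y * φ y) + (L ^ 2 + y ^ 2) * drift a Ω y * (der p y * φ y)
          + (L ^ 2 + y ^ 2) * potential L lam Ω y * (prim (der p) y * φ y)) := rfl
  have eInt := integral_congr_ae key
  have eL : (∫ y, ((L ^ 2 + y ^ 2) * (der p y * φ₁ y) + 2 * y * (der p y * φ y) + (L ^ 2 + y ^ 2) * drift a Ωs y * (der p y * φ y)
          + (L ^ 2 + y ^ 2) * potential L lam Ωs y * (prim (der p) y * φ y))
        - (L ^ 2 + y ^ 2) * (PopFun L lam a Ωs Ωs₁ p y * φ y)) =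
      (∫ y, ((L ^ 2 + y ^ 2) * (der p y * φ₁ y) + 2 * y * (der p y * φ y) + (L ^ 2 + y ^ 2) * drift a Ωs y * (der p y * φ y)
          + (L ^ 2 + y ^ 2) * potential L lam Ωs y * (prim (der p) y * φ y)))
        - ∫ y, (L ^ 2 + y ^ 2) * (PopFun L lam a Ωs Ωs₁ p y * φ y) := integral_sub hIs iPs
  have eR : (∫ y, ((L ^ 2 + y ^ 2) * (der p y * φ₁ y) + 2 * y * (der p y * φ y) + (L ^ 2 + y ^ 2) * drift a Ω y * (der p y * φ y)
          + (L ^ 2 + y ^ 2) * potential L lam Ω y * (prim (der p) y * φ y))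
        - (L ^ 2 + y ^ 2) * (PopFun L lam a Ω Ω₁ p y * φ y)
        + (L ^ 2 + y ^ 2) * ((QFun L a u p y + QFun L a p u y) * φ y)) =
      (∫ y, ((L ^ 2 + y ^ 2) * (der p y * φ₁ y) + 2 * y * (der p y * φ y) + (L ^ 2 + y ^ 2) * drift a Ω y * (der p y * φ y)
          + (L ^ 2 + y ^ 2) * potential L lam Ω y * (prim (der p) y * φ y)))
        - (∫ y, (L ^ 2 + y ^ 2) * (PopFun L lam a Ω Ω₁ p y * φ y))
        + ∫ y, (L ^ 2 + y ^ 2) * ((QFun L a u p y + QFun L a p u y) * φ y) := by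
    rw [integral_add _ iB, integral_sub hI iP]
    exact hI.sub iP
  -- the `K`-terms through `Pdata`
  have hKs : ∫ y, (L ^ 2 + y ^ 2) * ((((-PopC hL lam a hcs + F') p : W L) : ℝ → ℝ) y * φ y) =
      -(∫ y, (L ^ 2 + y ^ 2) * (((PopC hL lam a hcs p : W L) : ℝ → ℝ) y * φ y))
        + ∫ y, (L ^ 2 + y ^ 2) * (((F' p : W L) : ℝ → ℝ) y * φ y) := by
    rw [integral_weight_mul_eq_Pdata hL _ hφ, integral_weight_mul_eq_Pdata hL _ hφ, integral_weight_mul_eq_Pdata hL _ hφ,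
      _root_.add_apply, _root_.neg_apply, map_add (Pdata hL), map_neg (Pdata hL), LinearMap.add_apply, LinearMap.neg_apply]
  have hK : ∫ y, (L ^ 2 + y ^ 2) * ((((-PopC hL lam a hc + F' + (Qop hL a u + (Qop hL a).flip u)) p : W L) : ℝ → ℝ) y * φ y) =
      -(∫ y, (L ^ 2 + y ^ 2) * (((PopC hL lam a hc p : W L) : ℝ → ℝ) y * φ y))
        + (∫ y, (L ^ 2 + y ^ 2) * (((F' p : W L) : ℝ → ℝ) y * φ y))
        + ∫ y, (L ^ 2 + y ^ 2) * ((((Qop hL a u + (Qop hL a).flip u) p : W L) : ℝ → ℝ) y * φ y) := by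
    rw [integral_weight_mul_eq_Pdata hL _ hφ, integral_weight_mul_eq_Pdata hL (PopC hL lam a hc p) hφ,
      integral_weight_mul_eq_Pdata hL (F' p) hφ, integral_weight_mul_eq_Pdata hL ((Qop hL a u + (Qop hL a).flip u) p) hφ,
      _root_.add_apply, _root_.add_apply, _root_.neg_apply, map_add (Pdata hL), map_add (Pdata hL), map_neg (Pdata hL),
      LinearMap.add_apply, LinearMap.add_apply, LinearMap.neg_apply]
  rw [hKs, hK, hPs, hP, hB, hlinS, hlin]
  linarith

/-! ### §3 Re-encoding the Gårding datum and the weak image -/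

include hc hcs hsum in
/-- **THE (S1) DATUM, RE-ENCODED (centre → `Ω*`).** A Gårding datum `(c, m)` for the centre encoding
`(drift a Ω̄, potential L λ Ω̄, −PopC̄ + F′ + (Qop u + (Qop)ᵀ u))` — the output of (P8)'s `gardingDataKC_perturbedCentre` — is a Gårding
datum `(c, m)` for the `Ω*` encoding `(drift a Ω*, potential L λ Ω*, −PopC* + F′)` (coefficient fields from `coef_bounds` at `Ω*`:
`D₀* = |a|(π/(4L))^{1/2}‖Ω*‖_w`, `D₁ = ½`, `V₀* = 1 + H₀* + |λ|`). MODEL statement; not NS. [folklore] -/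
theorem gardingDataKC_reencode (F' : Esp L hL →L[ℝ] W L) {D₀ D₁ V₀ c m : ℝ}
    (h : GardingDataKC L hL (drift a Ω) (potential L lam Ω) (-PopC hL lam a hc + F' + (Qop hL a u + (Qop hL a).flip u)) D₀ D₁ V₀ c m) :
    GardingDataKC L hL (drift a Ωs) (potential L lam Ωs) (-PopC hL lam a hcs + F')
      (|a| * (Real.sqrt (π / (4 * L)) * Real.sqrt (∫ y, (L ^ 2 + y ^ 2) * Ωs y ^ 2))) (1 / 2) (1 + Hs + |lam|) c m := by
  obtain ⟨hdms, hVms, hds, hVs⟩ := coef_bounds hL lam a hcs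
  refine ⟨hdms, hVms, by positivity, by norm_num, hds, hVs, h.c_pos, fun vp => ?_⟩
  have hG := h.garding vp
  obtain ⟨hae, hprim⟩ := jmap_snd_ae hL vp
  have e1 : linForm L (drift a Ω) (potential L lam Ω) vp.1.1 vp.1.2 vp.1.1 vp.1.2 =
      linForm L (drift a Ω) (potential L lam Ω) (prim (der (jmap hL vp))) (der (jmap hL vp)) vp.1.1 vp.1.2 :=
    (linForm_congr_ae L _ _ (Eventually.of_forall fun y => congrFun hprim y) hae).symm
  have e2 : linForm L (drift a Ωs) (potential L lam Ωs) vp.1.1 vp.1.2 vp.1.1 vp.1.2 =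
      linForm L (drift a Ωs) (potential L lam Ωs) (prim (der (jmap hL vp))) (der (jmap hL vp)) vp.1.1 vp.1.2 :=
    (linForm_congr_ae L _ _ (Eventually.of_forall fun y => congrFun hprim y) hae).symm
  have key := weakForm_reencode hL lam a hc hcs u hsum F' (jmap hL vp) vp.2
  rw [e2, key, ← e1]
  exact hG

include hc hcs hsum in
/-- **… and back (`Ω*` → centre).** [folklore] -/
theorem gardingDataKC_reencode' (F' : Esp L hL →L[ℝ] W L) {D₀ D₁ V₀ c m : ℝ}
    (h : GardingDataKC L hL (drift a Ωs) (potential L lam Ωs) (-PopC hL lam a hcs + F') D₀ D₁ V₀ c m) :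
    GardingDataKC L hL (drift a Ω) (potential L lam Ω) (-PopC hL lam a hc + F' + (Qop hL a u + (Qop hL a).flip u))
      (|a| * (Real.sqrt (π / (4 * L)) * Real.sqrt (∫ y, (L ^ 2 + y ^ 2) * Ω y ^ 2))) (1 / 2) (1 + H₀ + |lam|) c m := by
  obtain ⟨hdm, hVm, hd, hV⟩ := coef_bounds hL lam a hc
  refine ⟨hdm, hVm, by positivity, by norm_num, hd, hV, h.c_pos, fun vp => ?_⟩
  have hG := h.garding vp
  obtain ⟨hae, hprim⟩ := jmap_snd_ae hL vp
  have e1 : linForm L (drift a Ω) (potential L lam Ω) vp.1.1 vp.1.2 vp.1.1 vp.1.2 =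
      linForm L (drift a Ω) (potential L lam Ω) (prim (der (jmap hL vp))) (der (jmap hL vp)) vp.1.1 vp.1.2 :=
    (linForm_congr_ae L _ _ (Eventually.of_forall fun y => congrFun hprim y) hae).symm
  have e2 : linForm L (drift a Ωs) (potential L lam Ωs) vp.1.1 vp.1.2 vp.1.1 vp.1.2 =
      linForm L (drift a Ωs) (potential L lam Ωs) (prim (der (jmap hL vp))) (der (jmap hL vp)) vp.1.1 vp.1.2 :=
    (linForm_congr_ae L _ _ (Eventually.of_forall fun y => congrFun hprim y) hae).symm
  have key := weakForm_reencode hL lam a hc hcs u hsum F' (jmap hL vp) vp.2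
  rw [e1, ← key, ← e2]
  exact hG

include hc hcs hsum in
/-- **The weak image re-encoded.** `IsWeakImage` (selfsim's «`A(u_R + iu_I) = F` weakly») holds in the `Ω*` encoding iff in the centre
encoding, for the same energy-space pair and the same datum. [folklore] -/
theorem isWeakImage_reencode (F' : Esp L hL →L[ℝ] W L) (P : WithLp 2 (Esp L hL × Esp L hL)) (G : Wc L) :
    IsWeakImage hL (-PopC hL lam a hcs + F') (drift a Ωs) (potential L lam Ωs) P G ↔
      IsWeakImage hL (-PopC hL lam a hc + F' + (Qop hL a u + (Qop hL a).flip u)) (drift a Ω) (potential L lam Ω) P G := by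
  constructor
  · intro hW v v₁ hv
    obtain ⟨h1, h2⟩ := hW v v₁ hv
    rw [weakForm_reencode hL lam a hc hcs u hsum F' P.fst hv] at h1
    rw [weakForm_reencode hL lam a hc hcs u hsum F' P.snd hv] at h2
    exact ⟨h1, h2⟩
  · intro hW v v₁ hv
    obtain ⟨h1, h2⟩ := hW v v₁ hv
    rw [← weakForm_reencode hL lam a hc hcs u hsum F' P.fst hv] at h1
    rw [← weakForm_reencode hL lam a hc hcs u hsum F' P.snd hv] at h2
    exact ⟨h1, h2⟩

/-! ### §4 The resolvents and the Evans functions of the two encodings coincide -/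

include hc hcs hsum in
/-- **The pair solution operators coincide.** For data of the two encodings with the same `m` (the output of `gardingDataKC_reencode` has the same
`(c, m)` as its input) and `Re σ > −m`: `pairOpKC` of the `Ω*` encoding equals `pairOpKC` of the centre encoding — the shifted weak pair systems
coincide test by test (`weakForm_reencode` + `linForm_shiftKC`), so uniqueness applies. [folklore] -/
theorem pairOpKC_reencode (F' : Esp L hL →L[ℝ] W L) {D₀ D₁ V₀ c D₀' D₁' V₀' c' m : ℝ}
    (h₁ : GardingDataKC L hL (drift a Ω) (potential L lam Ω) (-PopC hL lam a hc + F' + (Qop hL a u + (Qop hL a).flip u)) D₀ D₁ V₀ c m)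
    (h₂ : GardingDataKC L hL (drift a Ωs) (potential L lam Ωs) (-PopC hL lam a hcs + F') D₀' D₁' V₀' c' m)
    {σ : ℂ} (hσ : -m < σ.re) (G : WithLp 2 (W L × W L)) :
    pairOpKC hL _ h₂ σ hσ G = pairOpKC hL _ h₁ σ hσ G := by
  set Q := pairOpKC hL _ h₁ σ hσ G with hQ
  refine (pairOpKC_unique hL _ h₂ σ hσ G (Q := Q) fun v v₁ hv => ?_).symm
  obtain ⟨e1, e2⟩ := (pairOpKC_spec hL _ h₁ σ hσ).1 G v v₁ hv
  obtain ⟨-, -, hm1, h01, h11, -⟩ := profile_of_mem hL Q.fst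
  obtain ⟨-, -, hm2, h02, h12, -⟩ := profile_of_mem hL Q.snd
  have hc1 : AEStronglyMeasurable (prim (der Q.fst)) volume := (continuous_prim hL _).aestronglyMeasurable
  have hc2 : AEStronglyMeasurable (prim (der Q.snd)) volume := (continuous_prim hL _).aestronglyMeasurable
  obtain ⟨-, s11⟩ := linForm_shiftKC h₁ σ.re hv hc1 hm1 h01 h11
  obtain ⟨-, s12⟩ := linForm_shiftKC h₁ σ.re hv hc2 hm2 h02 h12
  obtain ⟨-, s21⟩ := linForm_shiftKC h₂ σ.re hv hc1 hm1 h01 h11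
  obtain ⟨-, s22⟩ := linForm_shiftKC h₂ σ.re hv hc2 hm2 h02 h12
  have r1 := weakForm_reencode hL lam a hc hcs u hsum F' Q.fst hv
  have r2 := weakForm_reencode hL lam a hc hcs u hsum F' Q.snd hv
  rw [s11] at e1
  rw [s12] at e2
  rw [s21, s22]
  constructor
  · linarith
  · linarith

include hc hcs hsum in
/-- **The resolvents coincide** (as bounded operators on `L²_w(ℂ)`, everywhere in `σ`: both vanish off the common half-plane `Re σ > −m`). [folklore] -/
theorem resolventKC_reencode (F' : Esp L hL →L[ℝ] W L) {D₀ D₁ V₀ c D₀' D₁' V₀' c' m : ℝ}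
    (h₁ : GardingDataKC L hL (drift a Ω) (potential L lam Ω) (-PopC hL lam a hc + F' + (Qop hL a u + (Qop hL a).flip u)) D₀ D₁ V₀ c m)
    (h₂ : GardingDataKC L hL (drift a Ωs) (potential L lam Ωs) (-PopC hL lam a hcs + F') D₀' D₁' V₀' c' m) (σ : ℂ) :
    resolventKC hL _ h₂ σ = resolventKC hL _ h₁ σ := by
  ext G : 1
  by_cases hσ : -m < σ.re
  · obtain ⟨e1, -, -, -⟩ := resolventKC_weak hL _ h₁ hσ G
    obtain ⟨e2, -, -, -⟩ := resolventKC_weak hL _ h₂ hσ G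
    rw [e1, e2, pairOpKC_reencode hL lam a hc hcs u hsum F' h₁ h₂ hσ]
  · rw [resolventKC_apply, resolventKC_apply, resolventRKC_of_not hL _ h₁ hσ, resolventRKC_of_not hL _ h₂ hσ]

include hc hcs hsum in
/-- **… on the odd class.** [folklore] -/
theorem resolventOdd_reencode (F' : Esp L hL →L[ℝ] W L) {D₀ D₁ V₀ c D₀' D₁' V₀' c' m : ℝ}
    (h₁ : GardingDataKC L hL (drift a Ω) (potential L lam Ω) (-PopC hL lam a hc + F' + (Qop hL a u + (Qop hL a).flip u)) D₀ D₁ V₀ c m)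
    (h₂ : GardingDataKC L hL (drift a Ωs) (potential L lam Ωs) (-PopC hL lam a hcs + F') D₀' D₁' V₀' c' m) (σ : ℂ) :
    resolventOdd hL _ h₂ σ = resolventOdd hL _ h₁ σ := by
  ext G : 1
  apply Subtype.ext
  rw [coe_resolventOdd, coe_resolventOdd, resolventKC_reencode hL lam a hc hcs u hsum F' h₁ h₂ σ]

include hc hcs hsum in
/-- **THE EVANS FUNCTIONS OF THE TWO ENCODINGS ARE THE SAME FUNCTION** (every `ℓ, f, θ`): so implementation 2's `RectLabelCertificate` / far field,
certified for the Evans function built on the centre encoding `(d̄, V̄, K̄ + B_u)` (cert-2 g8 file (C)), IS the hypothesis of the `Ω*`-encoded assembly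
(`SheetRSpectrumEndToEnd`), and conversely. [folklore] -/
theorem evansOdd_reencode (F' : Esp L hL →L[ℝ] W L) {D₀ D₁ V₀ c D₀' D₁' V₀' c' m : ℝ}
    (h₁ : GardingDataKC L hL (drift a Ω) (potential L lam Ω) (-PopC hL lam a hc + F' + (Qop hL a u + (Qop hL a).flip u)) D₀ D₁ V₀ c m)
    (h₂ : GardingDataKC L hL (drift a Ωs) (potential L lam Ωs) (-PopC hL lam a hcs + F') D₀' D₁' V₀' c' m)
    (ℓ : Wcodd L →L[ℂ] ℂ) (f : Wcodd L) (θ : ℂ) :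
    evansOdd hL _ h₂ ℓ f θ = evansOdd hL _ h₁ ℓ f θ := by
  funext σ
  rw [evansOdd_eq, evansOdd_eq]
  simp only [resolventOdd_reencode hL lam a hc hcs u hsum F' h₁ h₂ σ]

end SheetRCentreReencoding
end Summit.NavierStokesRegularity.OSWSelfSimilar

end
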